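import Mathlib
import Summits.KontsevichZagierPeriods.KontsevichZagierPeriods.Theorems.SoloInformedHesseTangential
import Literature.NumberTheory.Transcendental.SemialgebraicMaps
import Literature.NumberTheory.Transcendental.SemialgebraicVolume
import Literature.NumberTheory.Transcendental.KZCalculus
import Literature.NumberTheory.Transcendental.KZMellinFibres
import Literature.NumberTheory.Transcendental.KZSemialgebraicComplex
import Literature.NumberTheory.Transcendental.SemialgebraicMapsProofs
import HarnessLib
import HarnessLib.Audit

/-!
# SoloInformed — Gauss triplication by the moves, VI: cube roots on the box side

The left side of Gauss's triplication `B(⅓,s)B(⅔,s)` is the cube Beta representation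
`R = [(0,1)², x^{-2/3}(1-x)^{s-1} y^{-1/3}(1-y)^{s-1}]`. The change of variables
`(x, y) = (X³, Y³)` (rule (2); a `ℚ`-polynomial bijection of the open box, `|det| = 9X²Y²`)
turns it into the POLYNOMIALLY weighted representation `R′ = [(0,1)², 9·Y·((1−X³)(1−Y³))^{s−1}]`
(`soloInformed_cubeRootMove`), which exists as soon as `R` does (`soloInformed_exists_cubeRootRep`).

Residency `solo-KontsevichZagierPeriods-informed` (s71); paper §7 (c6)(x).
References: Kontsevich–Zagier, *Periods* (2001), §1.2 rule (2).
-/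

noncomputable section

open MeasureTheory Set Filter
namespace Summit.KontsevichZagierPeriods.KontsevichZagierPeriods.Theorems

open Literature.NumberTheory.Transcendental Literature.NumberTheory.Transcendental.KZ
open Literature.ModelTheory.ExponentialFields

/-! ### The box, its halves, the weight -/

/-- The open unit box `(0,1)²` (pinned as in `KZ.gaussMultiplication_toFormalPeriod`). [this work] -/
def soloInformedUnitBox : Set (Fin 2 → ℝ) := {x | ∀ i, x i ∈ Ioo (0:ℝ) 1}

/-- The lower half `H₁ = {0 < X < Y < 1}` of the box. [this work] -/
def soloInformedH1 : Set (Fin 2 → ℝ) := {X | 0 < X 0 ∧ X 0 < X 1 ∧ X 1 < 1}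

/-- The upper half `H₂ = {0 < Y < X < 1}` of the box. [this work] -/
def soloInformedH2 : Set (Fin 2 → ℝ) := {X | 0 < X 1 ∧ X 1 < X 0 ∧ X 0 < 1}

/-- The weight `c(X, Y) = (1 − X³)(1 − Y³)`. [this work] -/
def soloInformedBoxC (X : Fin 2 → ℝ) : ℝ := (1 - X 0 ^ 3) * (1 - X 1 ^ 3)

/-- Membership in the open box. [this work] -/
theorem soloInformed_mem_box {x : Fin 2 → ℝ} :
    x ∈ soloInformedUnitBox ↔ 0 < x 0 ∧ x 0 < 1 ∧ 0 < x 1 ∧ x 1 < 1 := by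
  simp only [soloInformedUnitBox, mem_setOf_eq, Fin.forall_fin_two, mem_Ioo, and_assoc]

/-- `H₁ ⊆ (0,1)²`. [this work] -/
theorem soloInformed_H1_subset_box : soloInformedH1 ⊆ soloInformedUnitBox := fun _ ⟨h0, h1, h2⟩ =>
  soloInformed_mem_box.2 ⟨h0, by linarith, by linarith, h2⟩

/-- `H₂ ⊆ (0,1)²`. [this work] -/
theorem soloInformed_H2_subset_box : soloInformedH2 ⊆ soloInformedUnitBox := fun _ ⟨h0, h1, h2⟩ =>
  soloInformed_mem_box.2 ⟨by linarith, h2, h0, by linarith⟩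

/-- `(0,1)²` is `ℚ`-semialgebraic. [this work] -/
theorem soloInformed_isSemialgebraic_box : IsSemialgebraic ℚ soloInformedUnitBox := by
  have h := isSemialgebraic_setOf_forall_aeval_pos
    ![(MvPolynomial.X 0 : MvPolynomial (Fin 2) ℚ), 1 - MvPolynomial.X 0, MvPolynomial.X 1, 1 - MvPolynomial.X 1]
  convert h using 1
  ext x
  simp only [soloInformed_mem_box, mem_setOf_eq, Fin.forall_fin_succ, Matrix.cons_val_zero, Matrix.cons_val_succ,
    map_sub, map_one, MvPolynomial.aeval_X, sub_pos]
  exact ⟨fun ⟨a, b, c, d⟩ => ⟨a, b, c, d, fun i => Fin.elim0 i⟩, fun ⟨a, b, c, d, _⟩ => ⟨a, b, c, d⟩⟩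

/-- `H₁` is `ℚ`-semialgebraic. [this work] -/
theorem soloInformed_isSemialgebraic_H1 : IsSemialgebraic ℚ soloInformedH1 := by
  have h := isSemialgebraic_setOf_forall_aeval_pos
    ![(MvPolynomial.X 0 : MvPolynomial (Fin 2) ℚ), MvPolynomial.X 1 - MvPolynomial.X 0, 1 - MvPolynomial.X 1]
  convert h using 1
  ext x
  simp only [soloInformedH1, mem_setOf_eq, Fin.forall_fin_succ, Matrix.cons_val_zero, Matrix.cons_val_succ,
    map_sub, map_one, MvPolynomial.aeval_X, sub_pos]
  exact ⟨fun ⟨a, b, c⟩ => ⟨a, b, c, fun i => Fin.elim0 i⟩, fun ⟨a, b, c, _⟩ => ⟨a, b, c⟩⟩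

/-- `H₂` is `ℚ`-semialgebraic. [this work] -/
theorem soloInformed_isSemialgebraic_H2 : IsSemialgebraic ℚ soloInformedH2 := by
  have h := isSemialgebraic_setOf_forall_aeval_pos
    ![(MvPolynomial.X 1 : MvPolynomial (Fin 2) ℚ), MvPolynomial.X 0 - MvPolynomial.X 1, 1 - MvPolynomial.X 0]
  convert h using 1
  ext x
  simp only [soloInformedH2, mem_setOf_eq, Fin.forall_fin_succ, Matrix.cons_val_zero, Matrix.cons_val_succ,
    map_sub, map_one, MvPolynomial.aeval_X, sub_pos]
  exact ⟨fun ⟨a, b, c⟩ => ⟨a, b, c, fun i => Fin.elim0 i⟩, fun ⟨a, b, c, _⟩ => ⟨a, b, c⟩⟩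

/-- The box is measurable. [folklore] -/
theorem soloInformed_measurableSet_box : MeasurableSet soloInformedUnitBox :=
  soloInformed_isSemialgebraic_box.measurableSet_holds

/-- `H₁` is measurable. [folklore] -/
theorem soloInformed_measurableSet_H1 : MeasurableSet soloInformedH1 :=
  soloInformed_isSemialgebraic_H1.measurableSet_holds

/-- `c > 0` on the box. [this work] -/
theorem soloInformed_boxC_pos {X : Fin 2 → ℝ} (hX : X ∈ soloInformedUnitBox) : 0 < soloInformedBoxC X := by
  obtain ⟨h0, h1, h2, h3⟩ := soloInformed_mem_box.1 hX
  have a : X 0 ^ 3 < 1 := pow_lt_one₀ h0.le h1 (by norm_num)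
  have b : X 1 ^ 3 < 1 := pow_lt_one₀ h2.le h3 (by norm_num)
  exact mul_pos (by linarith) (by linarith)

/-- `c` as the value of a `ℚ`-polynomial. [this work] -/
theorem soloInformed_aeval_boxC (X : Fin 2 → ℝ) :
    MvPolynomial.aeval X ((1 - MvPolynomial.X 0 ^ 3) * (1 - MvPolynomial.X 1 ^ 3) : MvPolynomial (Fin 2) ℚ) =
      soloInformedBoxC X := by
  simp [soloInformedBoxC]

/-- A polynomially weighted power of `c`, `p · c^{e}` with `p ∈ ℚ[X,Y]`, is `ℚ`-semialgebraic on any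
semialgebraic part of the box. [this work] -/
theorem soloInformed_isSemialgebraicFunOn_boxWeight {σ : Set (Fin 2 → ℝ)} (hσ : IsSemialgebraic ℚ σ)
    (hσb : σ ⊆ soloInformedUnitBox) (p : MvPolynomial (Fin 2) ℚ) (e : ℚ) :
    IsSemialgebraicFunOn ℚ σ (fun X => MvPolynomial.aeval X p * soloInformedBoxC X ^ ((e:ℚ):ℝ)) := by
  have hm := isSemialgebraicFunOn_mellinIntegrand hσ
    ![((1 - MvPolynomial.X 0 ^ 3) * (1 - MvPolynomial.X 1 ^ 3) : MvPolynomial (Fin 2) ℚ)] ![e] 1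
    (fun X hX k => by
      fin_cases k
      show 0 < MvPolynomial.aeval X ((1 - MvPolynomial.X 0 ^ 3) * (1 - MvPolynomial.X 1 ^ 3) : MvPolynomial (Fin 2) ℚ)
      rw [soloInformed_aeval_boxC]
      exact soloInformed_boxC_pos (hσb hX))
  refine (IsSemialgebraicFunOn.mul_holds (isSemialgebraicFunOn_aeval hσ p) hm).congr fun X _ => ?_
  simp [mellinIntegrand_apply, soloInformed_aeval_boxC]

/-! ### The cube map -/

/-- `(X, Y) ↦ (X³, Y³)`. [this work] -/
def soloInformedCubeMap (X : Fin 2 → ℝ) : Fin 2 → ℝ := ![X 0 ^ 3, X 1 ^ 3]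

/-- Its Jacobian matrix `diag(3X², 3Y²)`. [this work] -/
def soloInformedCubeD (X : Fin 2 → ℝ) : (Fin 2 → ℝ) →L[ℝ] (Fin 2 → ℝ) :=
  LinearMap.toContinuousLinearMap (Matrix.toLin' !![3 * X 0 ^ 2, 0; 0, 3 * X 1 ^ 2])

/-- First component of the cube map. [this work] -/
theorem soloInformedCube_zero (X : Fin 2 → ℝ) : soloInformedCubeMap X 0 = X 0 ^ 3 := rfl
/-- Second component of the cube map. [this work] -/
theorem soloInformedCube_one (X : Fin 2 → ℝ) : soloInformedCubeMap X 1 = X 1 ^ 3 := rfl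

/-- The (diagonal) derivative of the cube map, applied. [this work] -/
theorem soloInformedCubeD_apply (X v : Fin 2 → ℝ) :
    soloInformedCubeD X v 0 = 3 * X 0 ^ 2 * v 0 ∧ soloInformedCubeD X v 1 = 3 * X 1 ^ 2 * v 1 := by
  constructor
  · change Matrix.toLin' !![3 * X 0 ^ 2, 0; 0, 3 * X 1 ^ 2] v 0 = _
    rw [Matrix.toLin'_apply]
    simp [Matrix.mulVec, dotProduct, Fin.sum_univ_two]
  · change Matrix.toLin' !![3 * X 0 ^ 2, 0; 0, 3 * X 1 ^ 2] v 1 = _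
    rw [Matrix.toLin'_apply]
    simp [Matrix.mulVec, dotProduct, Fin.sum_univ_two]

/-- `det` of the derivative of the cube map. [this work] -/
theorem soloInformedCubeD_det (X : Fin 2 → ℝ) : (soloInformedCubeD X).det = 9 * X 0 ^ 2 * X 1 ^ 2 := by
  change LinearMap.det (Matrix.toLin' !![3 * X 0 ^ 2, 0; 0, 3 * X 1 ^ 2]) = _
  rw [LinearMap.det_toLin', Matrix.det_fin_two]
  simp only [Matrix.of_apply, Matrix.cons_val', Matrix.cons_val_zero, Matrix.cons_val_one,
    Matrix.cons_val_fin_one]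
  ring

/-- The cube map is differentiable with derivative `diag(3X², 3Y²)`. [this work] -/
theorem soloInformed_hasFDerivAt_cube (X : Fin 2 → ℝ) : HasFDerivAt soloInformedCubeMap (soloInformedCubeD X) X := by
  have h0 : HasFDerivAt (fun y : Fin 2 → ℝ => y 0)
      (ContinuousLinearMap.proj (R := ℝ) (φ := fun _ : Fin 2 => ℝ) 0) X := hasFDerivAt_apply 0 X
  have h1 : HasFDerivAt (fun y : Fin 2 → ℝ => y 1)
      (ContinuousLinearMap.proj (R := ℝ) (φ := fun _ : Fin 2 => ℝ) 1) X := hasFDerivAt_apply 1 X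
  rw [hasFDerivAt_pi']
  refine Fin.forall_fin_two.mpr ⟨?_, ?_⟩
  · have h := (h0.fun_mul h0).fun_mul h0
    have e : (fun y : Fin 2 → ℝ => soloInformedCubeMap y 0) = fun y => y 0 * y 0 * y 0 := by
      funext y; rw [soloInformedCube_zero]; ring
    rw [e]
    refine h.congr_fderiv (ContinuousLinearMap.ext fun v => ?_)
    simp only [ContinuousLinearMap.coe_comp, Function.comp_apply, ContinuousLinearMap.proj_apply,
      (soloInformedCubeD_apply X v).1, add_apply, smul_apply, smul_eq_mul]
    ring
  · have h := (h1.fun_mul h1).fun_mul h1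
    have e : (fun y : Fin 2 → ℝ => soloInformedCubeMap y 1) = fun y => y 1 * y 1 * y 1 := by
      funext y; rw [soloInformedCube_one]; ring
    rw [e]
    refine h.congr_fderiv (ContinuousLinearMap.ext fun v => ?_)
    simp only [ContinuousLinearMap.coe_comp, Function.comp_apply, ContinuousLinearMap.proj_apply,
      (soloInformedCubeD_apply X v).2, add_apply, smul_apply, smul_eq_mul]
    ring

/-- The cube map is injective on the box. [this work] -/
theorem soloInformed_injOn_cube : InjOn soloInformedCubeMap soloInformedUnitBox := by
  intro X hX X' hX' h
  obtain ⟨h0, -, h1, -⟩ := soloInformed_mem_box.1 hX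
  obtain ⟨h0', -, h1', -⟩ := soloInformed_mem_box.1 hX'
  have e0 := congrFun h 0
  have e1 := congrFun h 1
  rw [soloInformedCube_zero, soloInformedCube_zero] at e0
  rw [soloInformedCube_one, soloInformedCube_one] at e1
  funext i
  fin_cases i
  · exact (pow_left_inj₀ h0.le h0'.le (by norm_num)).1 e0
  · exact (pow_left_inj₀ h1.le h1'.le (by norm_num)).1 e1

/-- The cube map sends the box onto itself. [this work] -/
theorem soloInformed_image_cube : soloInformedCubeMap '' soloInformedUnitBox = soloInformedUnitBox := by
  ext x
  constructor
  · rintro ⟨X, hX, rfl⟩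
    obtain ⟨h0, h1, h2, h3⟩ := soloInformed_mem_box.1 hX
    exact soloInformed_mem_box.2 ⟨by rw [soloInformedCube_zero]; positivity,
      by rw [soloInformedCube_zero]; exact pow_lt_one₀ h0.le h1 (by norm_num),
      by rw [soloInformedCube_one]; positivity,
      by rw [soloInformedCube_one]; exact pow_lt_one₀ h2.le h3 (by norm_num)⟩
  · intro hx
    obtain ⟨h0, h1, h2, h3⟩ := soloInformed_mem_box.1 hx
    refine ⟨![x 0 ^ (((3:ℕ):ℝ)⁻¹), x 1 ^ (((3:ℕ):ℝ)⁻¹)], soloInformed_mem_box.2 ⟨?_, ?_, ?_, ?_⟩, ?_⟩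
    · simpa using Real.rpow_pos_of_pos h0 _
    · simpa using Real.rpow_lt_one h0.le h1 (by norm_num)
    · simpa using Real.rpow_pos_of_pos h2 _
    · simpa using Real.rpow_lt_one h2.le h3 (by norm_num)
    · funext i
      fin_cases i
      · simpa [soloInformedCubeMap] using Real.rpow_inv_natCast_pow h0.le (by norm_num : (3:ℕ) ≠ 0)
      · simpa [soloInformedCubeMap] using Real.rpow_inv_natCast_pow h2.le (by norm_num : (3:ℕ) ≠ 0)

/-- The cube map is `ℚ`-semialgebraic (polynomial) on the box. [this work] -/
theorem soloInformed_isSemialgebraicMapOn_cube : IsSemialgebraicMapOn ℚ soloInformedUnitBox soloInformedCubeMap := by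
  refine (isSemialgebraicMapOn_aeval soloInformed_isSemialgebraic_box
    (fun j : Fin 2 => (MvPolynomial.X j ^ 3 : MvPolynomial (Fin 2) ℚ))).congr fun X _ => ?_
  funext j
  fin_cases j <;> simp [soloInformedCubeMap]

/-! ### Rule (2) along the cube map -/

/-- `(X³)^{-2/3} · X² = 1` for `X > 0`. [folklore] -/
theorem soloInformed_cube_rpow_two_thirds {X : ℝ} (hX : 0 < X) : (X ^ 3) ^ (-(2 / 3 : ℝ)) * X ^ 2 = 1 := by
  rw [← Real.rpow_natCast X 3, ← Real.rpow_mul hX.le, ← Real.rpow_natCast X 2, ← Real.rpow_add hX]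
  norm_num

/-- `(Y³)^{-1/3} · Y² = Y` for `Y > 0`. [folklore] -/
theorem soloInformed_cube_rpow_one_third {X : ℝ} (hX : 0 < X) : (X ^ 3) ^ (-(1 / 3 : ℝ)) * X ^ 2 = X := by
  rw [← Real.rpow_natCast X 3, ← Real.rpow_mul hX.le, ← Real.rpow_natCast X 2, ← Real.rpow_add hX]
  norm_num

/-- The cube Beta integrand `x^{-2/3}(1-x)^{e} · y^{-1/3}(1-y)^{e}`. [this work] -/
def soloInformedCubeBeta (e : ℝ) (x : Fin 2 → ℝ) : ℝ :=
  x 0 ^ (-(2 / 3 : ℝ)) * (1 - x 0) ^ e * (x 1 ^ (-(1 / 3 : ℝ)) * (1 - x 1) ^ e)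

/-- The symmetrisable box integrand `9 · Y · c^{e}`. [this work] -/
def soloInformedBoxR (e : ℝ) (X : Fin 2 → ℝ) : ℝ := 9 * X 1 * soloInformedBoxC X ^ e

/-- The pull-back identity `9Y·c^e = (cube Beta integrand ∘ cube) · |det|` on the box. [this work] -/
theorem soloInformed_cube_pullback (e : ℝ) {X : Fin 2 → ℝ} (hX : X ∈ soloInformedUnitBox) :
    soloInformedBoxR e X = soloInformedCubeBeta e (soloInformedCubeMap X) * |(soloInformedCubeD X).det| := by
  obtain ⟨h0, h1, h2, h3⟩ := soloInformed_mem_box.1 hX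
  have a : X 0 ^ 3 < 1 := pow_lt_one₀ h0.le h1 (by norm_num)
  have b : X 1 ^ 3 < 1 := pow_lt_one₀ h2.le h3 (by norm_num)
  rw [soloInformedCubeD_det, abs_of_pos (by positivity)]
  unfold soloInformedBoxR soloInformedCubeBeta soloInformedBoxC
  rw [soloInformedCube_zero, soloInformedCube_one, Real.mul_rpow (by linarith) (by linarith)]
  have e0 := soloInformed_cube_rpow_two_thirds h0
  have e1 := soloInformed_cube_rpow_one_third h2
  calc 9 * X 1 * ((1 - X 0 ^ 3) ^ e * (1 - X 1 ^ 3) ^ e)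
      = 9 * ((X 0 ^ 3) ^ (-(2 / 3 : ℝ)) * X 0 ^ 2) * ((X 1 ^ 3) ^ (-(1 / 3 : ℝ)) * X 1 ^ 2) *
          ((1 - X 0 ^ 3) ^ e * (1 - X 1 ^ 3) ^ e) := by rw [e0, e1]; ring
    _ = _ := by ring

/-- **Rule (2) along the cube map**: `[(0,1)², x^{-2/3}(1-x)^e y^{-1/3}(1-y)^e] ∼ [(0,1)², 9Y c^e]`.
[this work] -/
theorem soloInformed_cubeRootMove (e : ℝ) (r R : IntegralRep 2) (hrd : r.domain = soloInformedUnitBox)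
    (hri : EqOn r.integrand (soloInformedCubeBeta e) r.domain) (hRd : R.domain = soloInformedUnitBox)
    (hRi : EqOn R.integrand (soloInformedBoxR e) R.domain) : Equivalent r R := by
  have h : of R - of r ∈ changeOfVariablesRel := by
    refine ⟨2, R, r, soloInformedCubeMap, soloInformedCubeD, by rw [hRd]; exact soloInformed_isSemialgebraicMapOn_cube,
      fun X _ => (soloInformed_hasFDerivAt_cube X).hasFDerivWithinAt, by rw [hRd]; exact soloInformed_injOn_cube,
      by rw [hrd, hRd, soloInformed_image_cube], fun X hX => ?_, rfl⟩
    have hX : X ∈ soloInformedUnitBox := by rw [← hRd]; exact hX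
    have hcX : soloInformedCubeMap X ∈ r.domain := by
      rw [hrd, ← soloInformed_image_cube]; exact mem_image_of_mem _ hX
    rw [hRi (by rw [hRd]; exact hX), hri hcX]
    exact soloInformed_cube_pullback e hX
  have h' : Equivalent R r := changeOfVariablesRel_subset_relations h
  exact h'.symm

/-- **The polynomially weighted representation exists** as soon as the cube Beta one does.
[this work] -/
theorem soloInformed_exists_cubeRootRep (s : ℚ) (r : IntegralRep 2) (hrd : r.domain = soloInformedUnitBox)
    (hri : EqOn r.integrand (soloInformedCubeBeta ((s:ℝ) - 1)) r.domain) :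
    ∃ R : IntegralRep 2, R.domain = soloInformedUnitBox ∧ R.integrand = soloInformedBoxR ((s:ℝ) - 1) := by
  have hint : IntegrableOn (soloInformedBoxR ((s:ℝ) - 1)) soloInformedUnitBox := by
    have h1 : IntegrableOn r.integrand (soloInformedCubeMap '' soloInformedUnitBox) := by
      rw [soloInformed_image_cube, ← hrd]; exact r.integrableOn
    rw [integrableOn_image_iff_integrableOn_abs_det_fderiv_smul volume soloInformed_measurableSet_box
      (fun X _ => (soloInformed_hasFDerivAt_cube X).hasFDerivWithinAt) soloInformed_injOn_cube] at h1
    refine h1.congr_fun (fun X hX => ?_) soloInformed_measurableSet_box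
    have hcX : soloInformedCubeMap X ∈ r.domain := by
      rw [hrd, ← soloInformed_image_cube]; exact mem_image_of_mem _ hX
    show |(soloInformedCubeD X).det| • r.integrand (soloInformedCubeMap X) = _
    rw [smul_eq_mul, hri hcX, mul_comm]
    exact (soloInformed_cube_pullback _ hX).symm
  have hsf : IsSemialgebraicFunOn ℚ soloInformedUnitBox (soloInformedBoxR ((s:ℝ) - 1)) := by
    refine (soloInformed_isSemialgebraicFunOn_boxWeight soloInformed_isSemialgebraic_box subset_rfl
      (MvPolynomial.C 9 * MvPolynomial.X 1) (s - 1)).congr fun X _ => ?_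
    simp [soloInformedBoxR]
  exact ⟨⟨_, _, soloInformed_isSemialgebraic_box, hsf, hint⟩, rfl, rfl⟩

end Summit.KontsevichZagierPeriods.KontsevichZagierPeriods.Theorems
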